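import Literature.NumberTheory.EllipticCurves.Sprung2017.HalfLogarithmMatrixLimit
import Mathlib.Analysis.SpecificLimits.Normed
import HarnessLib

/-!
# Sprung 2017 §3.1 at `(p, a_p) = (3, ±3)`: the derivative `ℒ′(0)` of the α-free half-logarithm matrix in
# CLOSED FORM (via `C⁶ = −27`) — proofs only

`Proofs` file (theorems only; no definition, no named fact) in the cluster `Sprung2017`, sequel of
`HalfLogarithmMatrixLimit.lean` (`halfLogMatrix b = ℒ(3, 3b) = lim_n 𝒞_1⋯𝒞_n C^{−(n+2)}`, coefficientwise
`3`-adic limit; `ℒ(0) = C^{−2}`). Source for the objects: F. Sprung, ANT 11 (2017) [Sprung2017] §1, §3.1.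

## What is proved
* `cast_coeff_zero_rowSeq` — `x^{(i)}_m(0) = (C^m)_{i1}` (`𝒞_j(0) = C`);
* `coeff_one_cycloDelta_three` — `(Φ_{3^{n+1}}(1+T) − 3)′(0) = 3^{n+1}`;
* `coeff_one_halfLogApprox` — `(A_n)′(0)_{ik} = −∑_{m<n} 3^{m+1}(C^m)_{i1}(C^{−(m+3)})_{0k}`;
* at `b = ±1` (`a_3 = ±3`, the elliptic-curve case): `sprungC_pow_six` (`C⁶ = −27·1`), `sprungCinv_pow_six`
  (`C^{−6} = −1/27·1`), the `6`-periodicity `term_{m+6} = 3⁶·term_m`, the closed form of the partial sums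
  along multiples of `6`, and **`coeff_one_halfLogMatrix`**: `ℒ′(0) = −S₆/728` with `S₆` the explicit sum
  of the first six terms — numerically `ℒ′(0) = (1/14 ±1/7; ∓2/7 −17/42)` (`coeff_one_halfLogMatrix_one`,
  `coeff_one_halfLogMatrix_neg_one`).
HONEST FRAMING: exact arithmetic about explicit matrices; nothing about any curve; BSD is not proved by any
of this. Consumer: the row-twist non-vanishing (Wronskian at `T = 0`) for stub S0 of the crux line
`chromatic-common-zeros` (stmt-BirchSwinnertonDyer-19875).
-/

noncomputable section

open Filter Topology Polynomial Finset

namespace Literature.NumberTheory.EllipticCurves.Sprung2017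

/-! ## §1 Constant terms of the rows: `x^{(i)}_m(0) = (C^m)_{i1}` -/

/-- Cayley–Hamilton for `C = (a 1; −p 0)`: `C² = a·C − p·1`. [folklore] -/
private theorem sprungC_sq (p : ℕ) (a : ℤ) : sprungC p a ^ 2 = (a : ℚ) • sprungC p a - (p : ℚ) • 1 := by
  ext i j
  fin_cases i <;> fin_cases j <;> simp [sprungC, pow_two] <;> ring

/-- Hence `(C^{m+2})_{ik} = a (C^{m+1})_{ik} − p (C^m)_{ik}`. [folklore] -/
private theorem sprungC_pow_add_two_apply (p : ℕ) (a : ℤ) (m : ℕ) (i k : Fin 2) :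
    (sprungC p a ^ (m + 2)) i k = (a : ℚ) * (sprungC p a ^ (m + 1)) i k - (p : ℚ) * (sprungC p a ^ m) i k := by
  rw [pow_add, sprungC_sq, mul_sub, Matrix.mul_smul, Matrix.mul_smul, mul_one, ← pow_succ]
  simp [Matrix.sub_apply, Matrix.smul_apply]

/-- **`x^{(i)}_m(0) = (C^m)_{i1}`**: the constant terms of `u_m`, `v_m` are the second column of `C^m`
(`𝒞_j(0) = C` because `Φ_{p^j}(1) = p`). [cite: Sprung2017, §3.1 (𝒞_i(ζ_{p^0}) = C)] -/
theorem cast_coeff_zero_rowSeq (p : ℕ) [Fact p.Prime] (a : ℤ) (i : Fin 2) (m : ℕ) :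
    (((rowSeq a p i m).coeff 0 : ℤ) : ℚ) = (sprungC p a ^ m) i 1 := by
  induction m using Nat.twoStepInduction with
  | zero => fin_cases i <;> simp [rowSeq]
  | one => fin_cases i <;> simp [rowSeq, sprungC]
  | more m ih0 ih1 =>
    have hΦ : ((cyclotomic (p ^ (m + 1)) ℤ).comp (X + 1)).coeff 0 = p := by
      rw [coeff_zero_eq_eval_zero, eval_comp, eval_add, eval_X, eval_one, zero_add,
        eval_one_cyclotomic_prime_pow]
    rw [rowSeq_add_two, coeff_sub, coeff_C_mul, mul_coeff_zero, hΦ, sprungC_pow_add_two_apply]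
    push_cast
    rw [ih0, ih1]

/-! ## §2 The linear coefficient of the approximants -/

/-- `(Φ_{3^{n+1}}(1+T) − 3)′(0) = 3^{n+1}` (from `(U−1)(U+2)`, `U = (1+T)^{3ⁿ}`: `0·? + 3ⁿ·3`). [folklore] -/
private theorem coeff_one_cycloDelta_three (n : ℕ) : (cycloDelta 3 (n + 1)).coeff 1 = 3 ^ (n + 1) := by
  rw [cycloDelta_three_eq, coeff_mul, Finset.Nat.sum_antidiagonal_succ, Finset.Nat.antidiagonal_zero, Finset.sum_singleton]
  simp [coeff_X_add_one_pow, pow_succ, Polynomial.coeff_one]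

/-- **`(A_n)′(0)_{ik} = −∑_{m<n} 3^{m+1}·(C^m)_{i1}·(C^{−(m+3)})_{0k}`** at `(p, a) = (3, 3b)` (the increment
`−(Φ_{3^{m+1}}(1+T) − 3)x_m (C^{−(m+3)})_{0k}` has linear coefficient `−3^{m+1} x_m(0) (C^{−(m+3)})_{0k}`, and
`A_0` is constant). [cite: Sprung2017, §3.1 (the partial products)] -/
theorem coeff_one_halfLogApprox (b : ℤ) (n : ℕ) (i k : Fin 2) :
    (halfLogApprox 3 (3 * b) n i k).coeff 1 =
      -∑ m ∈ range n, (3 : ℚ) ^ (m + 1) * (sprungC 3 (3 * b) ^ m) i 1 * (sprungCinv 3 (3 * b) ^ (m + 3)) 0 k := by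
  induction n with
  | zero => rw [halfLogApprox_zero, coeff_C, if_neg one_ne_zero, sum_range_zero, neg_zero]
  | succ n ih =>
    have h := congrArg (fun q : ℚ[X] => q.coeff 1) (halfLogApprox_succ_sub 3 (3 * b) n i k)
    simp only [coeff_sub, coeff_mul_C, coeff_neg, ← Polynomial.map_mul, Polynomial.coeff_map, eq_intCast]
      at h
    have h1 : (cycloDelta 3 (n + 1) * rowSeq (3 * b) 3 i n).coeff 1 = 3 ^ (n + 1) * (rowSeq (3 * b) 3 i n).coeff 0 := by
      rw [coeff_mul, Finset.Nat.sum_antidiagonal_succ, Finset.Nat.antidiagonal_zero, Finset.sum_singleton]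
      simp [coeff_zero_cycloDelta, coeff_one_cycloDelta_three]
    rw [h1] at h
    push_cast at h
    rw [cast_coeff_zero_rowSeq] at h
    rw [sum_range_succ, neg_add, ← ih]
    linear_combination h


/-! ## §3 `a_3 = ±3`: `C⁶ = −27`, the `6`-periodicity and the closed form of `ℒ′(0)` -/

section SixPeriodic

variable {b : ℤ} (hb : b = 1 ∨ b = -1)
include hb

/-- **`C⁶ = −27·1` at `a = ±3`, `p = 3`** (Cayley–Hamilton `C² = 3bC − 3` with `b² = 1`: `C³ = 6C − 9b`,
`C⁶ = (C³)² = −27`; the eigenvalues are `√3·ζ₁₂^{±1}` resp. `√3·ζ₁₂^{±5}`). [folklore] -/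
private theorem sprungC_pow_six : sprungC 3 (3 * b) ^ 6 = (-27 : ℚ) • (1 : Matrix (Fin 2) (Fin 2) ℚ) := by
  rcases hb with rfl | rfl <;>
  · ext i j
    fin_cases i <;> fin_cases j <;>
      norm_num [sprungC, pow_succ, Matrix.mul_apply, Fin.sum_univ_two, Matrix.one_apply]

/-- `C^{−6} = −(1/27)·1` at `a = ±3`. [folklore] -/
private theorem sprungCinv_pow_six : sprungCinv 3 (3 * b) ^ 6 = (-27 : ℚ)⁻¹ • (1 : Matrix (Fin 2) (Fin 2) ℚ) := by
  have hcomm : Commute (sprungCinv 3 (3 * b)) (sprungC 3 (3 * b)) := by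
    rw [Commute, SemiconjBy, sprungCinv_mul_sprungC, sprungC_mul_sprungCinv]
  have h : sprungCinv 3 (3 * b) ^ 6 * sprungC 3 (3 * b) ^ 6 = 1 := by
    rw [← hcomm.mul_pow, sprungCinv_mul_sprungC, one_pow]
  rw [sprungC_pow_six hb, Matrix.mul_smul, mul_one] at h
  rw [← h, smul_smul, inv_mul_cancel₀ (by norm_num), one_smul]

/-- **`6`-periodicity of the terms of `ℒ′(0)`**: with `t_m := 3^{m+1}(C^m)_{i1}(C^{−(m+3)})_{0k}`,
`t_{m+6} = 3⁶·t_m` (`C⁶ = −27`, `C^{−6} = −1/27`). [folklore] -/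
private theorem term_add_six (m : ℕ) (i k : Fin 2) :
    (3 : ℚ) ^ (m + 6 + 1) * (sprungC 3 (3 * b) ^ (m + 6)) i 1 * (sprungCinv 3 (3 * b) ^ (m + 6 + 3)) 0 k =
      729 * ((3 : ℚ) ^ (m + 1) * (sprungC 3 (3 * b) ^ m) i 1 * (sprungCinv 3 (3 * b) ^ (m + 3)) 0 k) := by
  rw [pow_add (sprungC 3 (3 * b)) m 6, sprungC_pow_six hb, show m + 6 + 3 = (m + 3) + 6 from rfl,
    pow_add (sprungCinv 3 (3 * b)) (m + 3) 6, sprungCinv_pow_six hb, Matrix.mul_smul, Matrix.mul_smul,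
    mul_one, mul_one, Matrix.smul_apply, Matrix.smul_apply, smul_eq_mul, smul_eq_mul]
  ring

/-- Hence `t_{m + 6q} = 729^q·t_m`. [folklore] -/
private theorem term_add_six_mul (m q : ℕ) (i k : Fin 2) :
    (3 : ℚ) ^ (m + 6 * q + 1) * (sprungC 3 (3 * b) ^ (m + 6 * q)) i 1 *
        (sprungCinv 3 (3 * b) ^ (m + 6 * q + 3)) 0 k =
      729 ^ q * ((3 : ℚ) ^ (m + 1) * (sprungC 3 (3 * b) ^ m) i 1 * (sprungCinv 3 (3 * b) ^ (m + 3)) 0 k) := by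
  induction q with
  | zero => simp
  | succ q ih =>
    rw [show m + 6 * (q + 1) = (m + 6 * q) + 6 from by ring, term_add_six hb, ih, pow_succ]
    ring

/-- **Closed form of the partial sums along multiples of `6`**:
`(1 − 3⁶)·∑_{m<6q} t_m = (1 − 3^{6q})·∑_{m<6} t_m`. [folklore] -/
private theorem sum_range_six_mul (q : ℕ) (i k : Fin 2) :
    (1 - 729 : ℚ) * ∑ m ∈ range (6 * q),
        (3 : ℚ) ^ (m + 1) * (sprungC 3 (3 * b) ^ m) i 1 * (sprungCinv 3 (3 * b) ^ (m + 3)) 0 k =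
      (1 - 729 ^ q) * ∑ m ∈ range 6,
        (3 : ℚ) ^ (m + 1) * (sprungC 3 (3 * b) ^ m) i 1 * (sprungCinv 3 (3 * b) ^ (m + 3)) 0 k := by
  induction q with
  | zero => simp
  | succ q ih =>
    rw [show 6 * (q + 1) = 6 * q + 6 from rfl, Finset.sum_range_add, mul_add, ih]
    have h6 : ∑ m ∈ range 6, (3 : ℚ) ^ (6 * q + m + 1) * (sprungC 3 (3 * b) ^ (6 * q + m)) i 1 *
          (sprungCinv 3 (3 * b) ^ (6 * q + m + 3)) 0 k =
        729 ^ q * ∑ m ∈ range 6,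
          (3 : ℚ) ^ (m + 1) * (sprungC 3 (3 * b) ^ m) i 1 * (sprungCinv 3 (3 * b) ^ (m + 3)) 0 k := by
      rw [Finset.mul_sum]
      refine Finset.sum_congr rfl fun m _ => ?_
      rw [show 6 * q + m = m + 6 * q from by ring, term_add_six_mul hb]
    rw [h6, pow_succ]
    ring

/-- **`ℒ′(0)` in closed form** at `a_3 = ±3`: for every entry,
`coeff_T ℒ_{ik} = (∑_{m<6} 3^{m+1}(C^m)_{i1}(C^{−(m+3)})_{0k}) / 728` — the `3`-adic limit of
`−∑_{m<n} t_m` along `n = 6q` is `−T₆·lim (1 − 3^{6q})/(1 − 3⁶) = −T₆/(1 − 3⁶) = T₆/728` (`3^{6q} → 0` in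
`ℚ_3`), and it equals the limit of the whole sequence (`tendsto_coeffSeq`). [cite: Sprung2017, §3.1 (Log_{α,β} as a limit)] -/
theorem coeff_one_halfLogMatrix (i k : Fin 2) :
    PowerSeries.coeff 1 (halfLogMatrix b i k) =
      (((∑ m ∈ range 6, (3 : ℚ) ^ (m + 1) * (sprungC 3 (3 * b) ^ m) i 1 *
        (sprungCinv 3 (3 * b) ^ (m + 3)) 0 k) / 728 : ℚ) : ℚ_[3]) := by
  set T₆ : ℚ := ∑ m ∈ range 6, (3 : ℚ) ^ (m + 1) * (sprungC 3 (3 * b) ^ m) i 1 *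
    (sprungCinv 3 (3 * b) ^ (m + 3)) 0 k with hT₆
  -- the subsequence `n = 6q` of the coefficient sequence
  have hsub : Tendsto (fun q : ℕ => coeffSeq b (6 * q) i k 1) atTop
      (𝓝 (PowerSeries.coeff 1 (halfLogMatrix b i k))) :=
    (tendsto_coeffSeq b i k 1).comp (tendsto_id.const_mul_atTop' (by norm_num : 0 < 6))
  -- its explicit form
  have hform : ∀ q : ℕ, coeffSeq b (6 * q) i k 1 =
      -((T₆ : ℚ_[3]) * ((1 - (729 : ℚ_[3]) ^ q) / (1 - 729))) := by
    intro q
    have h := sum_range_six_mul hb q i k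
    rw [← hT₆] at h
    have h' : ∑ m ∈ range (6 * q), (3 : ℚ) ^ (m + 1) * (sprungC 3 (3 * b) ^ m) i 1 *
        (sprungCinv 3 (3 * b) ^ (m + 3)) 0 k = T₆ * ((1 - 729 ^ q) / (1 - 729)) := by
      field_simp
      linear_combination h
    rw [coeffSeq, coeff_one_halfLogApprox, h']
    push_cast
    ring
  -- `729^q → 0` in `ℚ_3`
  have h729 : Tendsto (fun q : ℕ => (729 : ℚ_[3]) ^ q) atTop (𝓝 0) := by
    apply tendsto_pow_atTop_nhds_zero_of_norm_lt_one
    have h3 : ((3 : ℕ) : ℚ_[3]) ^ 6 = 729 := by norm_num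
    rw [← h3, norm_pow, Padic.norm_p]
    norm_num
  have hlim : Tendsto (fun q : ℕ => coeffSeq b (6 * q) i k 1) atTop
      (𝓝 (-((T₆ : ℚ_[3]) * ((1 - 0) / (1 - 729))))) := by
    simp_rw [hform]
    exact ((tendsto_const_nhds.sub h729).div_const _ |>.const_mul _).neg
  have heq := tendsto_nhds_unique hsub hlim
  rw [heq]
  push_cast
  ring

end SixPeriodic



/-! ## §4 The explicit values of `ℒ′(0)` at `a_3 = 3` and `a_3 = −3` -/

/-- The six-term sums `T₆ = ∑_{m<6} 3^{m+1}(C^m)_{i1}(C^{−(m+3)})_{0k}` at `a_3 = 3`: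
`T₆ = (52 104; −208 −884/3)`. [folklore] -/
private theorem sum_range_six_eq_one (i k : Fin 2) :
    ∑ m ∈ range 6, (3 : ℚ) ^ (m + 1) * (sprungC 3 (3 * 1) ^ m) i 1 * (sprungCinv 3 (3 * 1) ^ (m + 3)) 0 k =
      (!![52, 104; -208, -884 / 3] : Matrix (Fin 2) (Fin 2) ℚ) i k := by
  fin_cases i <;> fin_cases k <;>
    norm_num [Finset.sum_range_succ, sprungC, sprungCinv, pow_succ, Matrix.mul_apply, Fin.sum_univ_two]

/-- The six-term sums at `a_3 = −3`: `T₆ = (52 −104; 208 −884/3)`. [folklore] -/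
private theorem sum_range_six_eq_neg_one (i k : Fin 2) :
    ∑ m ∈ range 6, (3 : ℚ) ^ (m + 1) * (sprungC 3 (3 * (-1)) ^ m) i 1 *
        (sprungCinv 3 (3 * (-1)) ^ (m + 3)) 0 k =
      (!![52, -104; 208, -884 / 3] : Matrix (Fin 2) (Fin 2) ℚ) i k := by
  fin_cases i <;> fin_cases k <;>
    norm_num [Finset.sum_range_succ, sprungC, sprungCinv, pow_succ, Matrix.mul_apply, Fin.sum_univ_two]

/-- **`ℒ′(0)` at `a_3 = 3`**: `(1/14 1/7; −2/7 −17/42)`. [cite: Sprung2017, §3.1 (Log_{α,β} at p = 3, a_3 = 3)] -/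
theorem coeff_one_halfLogMatrix_one (i k : Fin 2) :
    PowerSeries.coeff 1 (halfLogMatrix 1 i k) =
      (((!![1 / 14, 1 / 7; -2 / 7, -17 / 42] : Matrix (Fin 2) (Fin 2) ℚ) i k : ℚ) : ℚ_[3]) := by
  rw [coeff_one_halfLogMatrix (Or.inl rfl), show (3 : ℤ) * 1 = 3 * 1 from rfl, sum_range_six_eq_one]
  congr 1
  fin_cases i <;> fin_cases k <;> norm_num

/-- **`ℒ′(0)` at `a_3 = −3`**: `(1/14 −1/7; 2/7 −17/42)`. [cite: Sprung2017, §3.1 (Log_{α,β} at p = 3, a_3 = −3)] -/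
theorem coeff_one_halfLogMatrix_neg_one (i k : Fin 2) :
    PowerSeries.coeff 1 (halfLogMatrix (-1) i k) =
      (((!![1 / 14, -1 / 7; 2 / 7, -17 / 42] : Matrix (Fin 2) (Fin 2) ℚ) i k : ℚ) : ℚ_[3]) := by
  rw [coeff_one_halfLogMatrix (Or.inr rfl), sum_range_six_eq_neg_one]
  congr 1
  fin_cases i <;> fin_cases k <;> norm_num

/-- `ℒ(0) = C^{−2}` at `a_3 = 3`: `(−1/3 −1/3; 1 2/3)`. [cite: Sprung2017, §3.1] -/
theorem coeff_zero_halfLogMatrix_one (i k : Fin 2) :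
    PowerSeries.coeff 0 (halfLogMatrix 1 i k) =
      (((!![-1 / 3, -1 / 3; 1, 2 / 3] : Matrix (Fin 2) (Fin 2) ℚ) i k : ℚ) : ℚ_[3]) := by
  rw [coeff_zero_halfLogMatrix]
  congr 1
  fin_cases i <;> fin_cases k <;> norm_num [sprungCinv, pow_two, Matrix.mul_apply, Fin.sum_univ_two]

/-- `ℒ(0) = C^{−2}` at `a_3 = −3`: `(−1/3 1/3; −1 2/3)`. [cite: Sprung2017, §3.1] -/
theorem coeff_zero_halfLogMatrix_neg_one (i k : Fin 2) :
    PowerSeries.coeff 0 (halfLogMatrix (-1) i k) =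
      (((!![-1 / 3, 1 / 3; -1, 2 / 3] : Matrix (Fin 2) (Fin 2) ℚ) i k : ℚ) : ℚ_[3]) := by
  rw [coeff_zero_halfLogMatrix]
  congr 1
  fin_cases i <;> fin_cases k <;> norm_num [sprungCinv, pow_two, Matrix.mul_apply, Fin.sum_univ_two]

end Literature.NumberTheory.EllipticCurves.Sprung2017

end
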